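import Summits.QuantumFields.YangMills.Theorems.AlphaInputsT3ACv3StartSystem
import Summits.QuantumFields.YangMills.Theorems.AlphaInputsT3ACv3SectionCorner
import Literature.MathematicalPhysics.QuantumFieldTheory.Balaban1983to89.B7BlockAvgLog
import HarnessLib

/-!
# `AlphaInputsT3ACv3StartSystemCoverage` — START v3.1 (S5)-4b, file 2: **THE (htube) AND ★★ (A5 = hcov) BINDERS OF `StartAssembly.dist1_plaqHol_startU_le`, DISCHARGED** — generically for
# ANY quadrant rule `σ : Plaq → Bool × Bool` and transverse forms `t_Q = s + β_{r,σ(Q)}`, for ANY constraint predicate `C` implied by «all four corners in Ω» (LEAD 03:36:30Z: so that the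
# ball-system shell reuses them), and instantiated at the canonical system of ★w1 g2 LEAD's `…v3StartSystem` (`tfOf k Ω`, `IsTubeΩ k Ω`, `FpOf k V`, radii `rT`, `RtT`): ★★ `hcov_startSys` —
# cell `ym3-torus`, width seat `ym-ust-19936-w2` (g2)

WHY ((S5)-4b OF RECORD, OWNER 03:32Z: «the three binders (hbox)∕(hsep)∕(hcov) at these instances + their shell twins»; split w2 = hbox∕hcov∕htube-side).  COVERAGE: by `…SectionCorner`, a
non-flat section plaquette `q` is doubly-last, sits at chart `(0,0,·)` of `Q₀ = ⟨coarsen k q.src; q.μ, q.ν⟩` and reads `V(∂Q₀)`; its four corners in `Ω` and `k`-saturation put the four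
cells of `Q₀` in `Ω` (`Q₀` IS a tube); the `ν`-bond of `q` from chart `(1,0)` (quadrant sign `negμ = false`) or from `(0,0)` (`negμ = true`) carries `β = ±2r/(2r+1) ≠ 0` and no string, so
the graft reads `G⁻¹·expSU(βF′)·G′` against the section's `G⁻¹·G′`: they differ unless `expSU(βF′) = 1`, which for `‖F′‖ < log 2` forces `F′ = 0` (`B7BlockAvgLog.mlog_exp`), i.e. `V(∂Q₀) = 1`,
i.e. the section plaquette WAS flat.  (htube): transverse plaquettes carry `|curl t| ≤ (2r+1)⁻²`, all others `0` (LEAD's `abs_curlB_tfOf_le_all`), and `exp` is monotone.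
WHAT.  §1 `htube_of_abs_curlB_le` (generic), ★ `htube_startSys`; §2 `isTube_of_corner`, `hstepC_one` (`h_C(1) = 2r/(2r+1)`), `tf_nu_bond`, ★ `tubeField_ne_iterSec_of_nu_bond` (generic `r, σ, Rt, Fp`),
★★ `hcov_of_corners` (generic, any `C` with `C q → q ∈ plaqsIn 0 Ω`), ★★ `hcov_startSys` (the canonical instance: `16 ≤ L^k`, `4·L^k ≤ N₀`, `Ω` `k`-saturated, `V` in the log window on
the tubes).  Def-free.
HONEST FRAMING.  Bookkeeping over the LEAD's (S5)-2∕4a∕4-defs and my (S1′)∕file 1; the only analysis is `mlog_exp`.  Count-neutral helper toward the (FL) row of 2′∕2′χ (`--supports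
stmt-QuantumFields-19936`); (A3 = hbox) is the next file, (A4 = hsep) is the second hand's; (FL)∕`hLift`, the stub, the crux and the gap are NOT claimed; registry untouched.  YM₃ on T³ is
RUNG R3 of the programme, not the Clay problem.

References: T. Bałaban, Commun. Math. Phys. 102 (1985) 277–309 [Balaban1985Variational] ((11)–(14) pp.279–280); Commun. Math. Phys. 98 (1985) 17–51 [Balaban1985Averaging] ((12) p.19, (21) p.21).
-/

set_option autoImplicit false

noncomputable section

open scoped Matrix.Norms.L2Operator

namespace Summit.QuantumFields.YangMills.Theorems.TubeStart

open Literature.MathematicalPhysics.QuantumFieldTheory.Balaban1983to89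
open Literature.MathematicalPhysics.QuantumFieldTheory.Balaban1983to89.T4AdjointCovarianceUnitary (lieSU expSU coe_expSU)
open Literature.MathematicalPhysics.QuantumFieldTheory.Balaban1983to89.BlockAveragingSectionAction (iterSec)
open Literature.MathematicalPhysics.QuantumFieldTheory.Balaban1983to89.B10Eq38TorusDomains (toFine plaqsIn cornerSet mem_plaqsIn_iff)
open Summit.QuantumFields.Balaban3D.Carriers
open Summit.QuantumFields.YangMills.Theorems.ModelBox
open Summit.QuantumFields.YangMills.Theorems.TubeProfile (betaQB betaQB_apply_snd betaQY hstepQ hstepC cntC)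

variable {P : Params}

/-! ## §1 (htube) the tube budget -/

section Budget

variable {n : Type*} [Fintype n] [DecidableEq n] {k : ℕ}

/-- **(htube), GENERIC**: from a uniform curl window `|curlB t_Q| ≤ c` on the tubes and `‖F′_Q‖ ≤ f` the tube budget binder holds with `b_T := exp(c·f) − 1`. [cite: Balaban1985Averaging, (12) p.19] -/
theorem htube_of_abs_curlB_le (IsTube : Plaq P k → Prop) (tf : Plaq P k → (Fin P.d → ℤ) → Fin P.d → ℝ) (Fp : Plaq P k → lieSU n) {c f : ℝ} (hc : 0 ≤ c)
    (hcurl : ∀ Q, IsTube Q → ∀ u α β, |curlB (tf Q) u α β| ≤ c) (hFp : ∀ Q, IsTube Q → ‖((Fp Q : lieSU n) : Matrix n n ℂ)‖ ≤ f) :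
    ∀ Q, IsTube Q → ∀ u α β, Real.exp (|curlB (tf Q) u α β| * ‖((Fp Q : lieSU n) : Matrix n n ℂ)‖) - 1 ≤ Real.exp (c * f) - 1 := by
  intro Q hQ u α β
  have h1 := hcurl Q hQ u α β
  have h2 := hFp Q hQ
  have h3 : |curlB (tf Q) u α β| * ‖((Fp Q : lieSU n) : Matrix n n ℂ)‖ ≤ c * f := mul_le_mul h1 h2 (norm_nonneg _) hc
  linarith [Real.exp_le_exp.mpr h3]

variable [Nonempty n]

/-- **★ (htube) FOR THE CANONICAL SYSTEM** of `…v3StartSystem`: `exp(|curlB (tfOf k Ω Q)|·‖FpOf k V Q‖) − 1 ≤ exp(f/(2·rT+1)²) − 1` whenever `‖FpOf k V Q‖ ≤ f` on the tubes.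
[cite: Balaban1985Variational, (14) p.280] -/
theorem htube_startSys (k : ℕ) (Ω : Set (Site P 0)) (V : GaugeField P k (Matrix.specialUnitaryGroup n ℂ)) {f : ℝ}
    (hFp : ∀ Q, IsTubeΩ k Ω Q → ‖((FpOf k V Q : lieSU n) : Matrix n n ℂ)‖ ≤ f) :
    ∀ Q, IsTubeΩ k Ω Q → ∀ u α β, Real.exp (|curlB (tfOf k Ω Q) u α β| * ‖((FpOf k V Q : lieSU n) : Matrix n n ℂ)‖) - 1 ≤ Real.exp (((2 * (rT P k : ℝ) + 1))⁻¹ ^ 2 * f) - 1 :=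
  htube_of_abs_curlB_le (IsTubeΩ k Ω) (tfOf k Ω) (FpOf k V) (by positivity) (fun Q _ u α β => abs_curlB_tfOf_le_all k Ω Q u α β) hFp

end Budget

/-! ## §2 (A5 = hcov) coverage -/

section Coverage

variable {n : Type*} [Fintype n] [DecidableEq n] [Nonempty n] {k : ℕ}

/-- `h_C(1) = 1 − 1/(2r+1) = 2r/(2r+1)`. [folklore] -/
theorem hstepC_one (r : ℕ) : hstepC r 1 = 1 - ((2 * (r : ℝ) + 1))⁻¹ := by
  unfold hstepC cntC TubeProfile.cnt
  have hc : max 0 (min ((1 : ℤ) - r + r) (2 * r + 1)) = 1 := by omega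
  rw [if_pos one_pos, hc]
  push_cast; ring

/-- **THE EDGE OF A CONSTRAINED DOUBLY-LAST PLAQUETTE IS A TUBE**: its four cells lie in `Ω` (`k`-saturation). [cite: Balaban1985UV3, (39) p.266] -/
theorem isTube_of_corner (hk : k ≤ P.m + P.K) (Ω : Set (Site P 0)) (hsat : ∀ x x' : Site P 0, coarsen k x = coarsen k x' → (x ∈ Ω ↔ x' ∈ Ω))
    (htf : ∀ z : Site P k, coarsen k (toFine k z) = z) (q : Plaq P 0) (hq : q ∈ plaqsIn 0 Ω) (hμ : IsLast k q.src q.μ) (hν : IsLast k q.src q.ν) :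
    (⟨coarsen k q.src, q.μ, q.ν, q.hμν⟩ : Plaq P k) ∈ plaqsIn k Ω := by
  have hne : q.μ ≠ q.ν := ne_of_lt q.hμν
  rw [mem_plaqsIn_iff] at hq ⊢
  simp only [cornerSet, B10Eq38TorusDomains.toFine_zero, Set.insert_subset_iff, Set.singleton_subset_iff] at hq
  obtain ⟨h1, h2, h3, h4⟩ := hq
  have hν' : IsLast k (q.src.shift q.μ) q.ν := (isLast_shift_of_ne k q.src hne.symm).mpr hν
  have c2 : coarsen k (q.src.shift q.μ) = (coarsen k q.src).shift q.μ := coarsen_shift_of_last k hk q.src q.μ hμ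
  have c3 : coarsen k (q.src.shift q.ν) = (coarsen k q.src).shift q.ν := coarsen_shift_of_last k hk q.src q.ν hν
  have c4 : coarsen k ((q.src.shift q.μ).shift q.ν) = ((coarsen k q.src).shift q.μ).shift q.ν := by
    rw [coarsen_shift_of_last k hk _ q.ν hν', c2]
  have key : ∀ (x : Site P 0) (z : Site P k), x ∈ Ω → coarsen k x = z → toFine k z ∈ Ω := fun x z hx hz =>
    (hsat x (toFine k z) (by rw [htf, hz])).mp hx
  simp only [cornerSet, Set.insert_subset_iff, Set.singleton_subset_iff]
  exact ⟨key _ _ h1 rfl, key _ _ h2 c2, key _ _ h3 c3, key _ _ h4 c4⟩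

variable (σ : Plaq P k → Bool × Bool) (r : ℕ) (V : GaugeField P k (Matrix.specialUnitaryGroup n ℂ)) (Rt : ℕ) (Fp : Plaq P k → lieSU n)

omit [Nonempty n] in
/-- **THE TEST BOND CARRIES `β = ±2r/(2r+1)` AND NO STRING**: for `t_Q = s + β_{r,σ(Q)}`, at chart `w` with `w_ν = 0` and `w_μ = (if (σ Q).1 then 0 else 1)`: `t_Q(w, ν) = ±(1 − 1/(2r+1))`.
[folklore] -/
theorem tf_nu_bond (Q : Plaq P k) (w : Fin P.d → ℤ) (hwν : w Q.ν = 0) (hwμ : w Q.μ = if (σ Q).1 then 0 else 1) :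
    (stringInd Q.μ Q.ν + betaQB r (σ Q).1 (σ Q).2 Q.μ Q.ν) w Q.ν = if (σ Q).1 then -(1 - ((2 * (r : ℝ) + 1))⁻¹) else 1 - ((2 * (r : ℝ) + 1))⁻¹ := by
  have hμν : Q.μ ≠ Q.ν := ne_of_lt Q.hμν
  rw [Pi.add_apply, Pi.add_apply, stringInd_of_ne Q.μ Q.ν hμν.symm, zero_add, betaQB_apply_snd r _ _ Q.μ Q.ν hμν]
  unfold betaQY TubeProfile.delta0
  rw [hwν, if_pos rfl, mul_one, hwμ]
  unfold hstepQ
  cases (σ Q).1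
  · simp only [Bool.false_eq_true, ↓reduceIte]; exact hstepC_one r
  · simp only [↓reduceIte, sub_zero]; rw [hstepC_one]

/-- **★ THE TEST BOND IS ACTIVE UNLESS THE COARSE PLAQUETTE IS TRIVIAL** (generic `r ≥ 1`, rule `σ`, radii, logarithms): for the forms `t = s + β_{r,σ}`, a tube `Q` with `expSU F′_Q =` the
`V(∂Q)⁻¹`-word, `‖F′_Q‖ < log 2` and `V(∂Q) ≠ 1`, the graft differs from the section on the `ν`-bond from chart `w` (`w_ν = 0`, `w_μ ∈ {0,1}` by the sign, both endpoints in the box).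
[cite: Balaban1985Variational, (11) p.279; Balaban1985Averaging, (21) p.21] -/
theorem tubeField_ne_iterSec_of_nu_bond (hk : k ≤ P.m + P.K) (hr : 1 ≤ r) (hRt : Rt + 2 ≤ P.L ^ k) (hN : 2 * max Rt (P.L ^ k / 2) + 1 ≤ P.sitesPerDir 0) (Q : Plaq P k)
    (hF : expSU (Fp Q) = V ⟨Q.src, Q.ν⟩ * V ⟨Q.src.shift Q.ν, Q.μ⟩ * (V ⟨Q.src.shift Q.μ, Q.ν⟩)⁻¹ * (V ⟨Q.src, Q.μ⟩)⁻¹)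
    (hFn : ‖((Fp Q : lieSU n) : Matrix n n ℂ)‖ < Real.log 2) (hne : GaugeField.plaqHol V Q ≠ 1)
    (w : Fin P.d → ℤ) (hwν : w Q.ν = 0) (hwμ : w Q.μ = if (σ Q).1 then 0 else 1)
    (hwT : InTube Q.μ Q.ν Rt (P.L ^ k / 2) w) (hwT' : InTube Q.μ Q.ν Rt (P.L ^ k / 2) (w + e Q.ν)) :
    tubeField k V Rt Fp (fun Q => stringInd Q.μ Q.ν + betaQB r (σ Q).1 (σ Q).2 Q.μ Q.ν) Q ⟨boxSite (cornerSite k Q.src Q.μ Q.ν) w, Q.ν⟩ ≠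
      iterSec k V ⟨boxSite (cornerSite k Q.src Q.μ Q.ν) w, Q.ν⟩ := by
  have hμν : Q.μ ≠ Q.ν := ne_of_lt Q.hμν
  intro heq
  have hgraft : tubeField k V Rt Fp (fun Q => stringInd Q.μ Q.ν + betaQB r (σ Q).1 (σ Q).2 Q.μ Q.ν) Q ⟨boxSite (cornerSite k Q.src Q.μ Q.ν) w, Q.ν⟩ =
      tubeU Q.μ Q.ν (V ⟨Q.src, Q.μ⟩) (V ⟨Q.src.shift Q.μ, Q.ν⟩) (V ⟨Q.src, Q.ν⟩) (Fp Q) (stringInd Q.μ Q.ν + betaQB r (σ Q).1 (σ Q).2 Q.μ Q.ν) w Q.ν := by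
    unfold tubeField
    exact graft_apply_boxSite _ Q.μ Q.ν hN _ _ hwT hwT'
  have hsec : iterSec k V ⟨boxSite (cornerSite k Q.src Q.μ Q.ν) w, Q.ν⟩ =
      tubeU Q.μ Q.ν (V ⟨Q.src, Q.μ⟩) (V ⟨Q.src.shift Q.μ, Q.ν⟩) (V ⟨Q.src, Q.ν⟩) (Fp Q) (stringInd Q.μ Q.ν) w Q.ν := by
    rw [← graft_tubeU_apply_eq_iterSec hk Q.src hμν hRt hN V (Fp Q) hF (stringInd Q.μ Q.ν) hwT hwT' rfl]
    exact graft_apply_boxSite _ Q.μ Q.ν hN _ _ hwT hwT'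
  rw [hgraft, hsec] at heq
  unfold tubeU at heq
  have hexp : expSU ((stringInd Q.μ Q.ν + betaQB r (σ Q).1 (σ Q).2 Q.μ Q.ν) w Q.ν • Fp Q) = expSU (stringInd Q.μ Q.ν w Q.ν • Fp Q) :=
    mul_left_cancel (mul_right_cancel heq)
  rw [stringInd_of_ne Q.μ Q.ν hμν.symm, zero_smul, expSU_zero', tf_nu_bond σ r Q w hwν hwμ] at hexp
  -- `expSU (β • F′) = 1` with `‖β • F′‖ < log 2` forces `F′ = 0`
  obtain ⟨β, hβ⟩ : ∃ β : ℝ, β = (if (σ Q).1 then -(1 - ((2 * (r : ℝ) + 1))⁻¹) else 1 - ((2 * (r : ℝ) + 1))⁻¹) := ⟨_, rfl⟩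
  rw [← hβ] at hexp
  have hn : (0 : ℝ) < 2 * (r : ℝ) + 1 := by positivity
  have hi0 : 0 ≤ ((2 * (r : ℝ) + 1))⁻¹ := inv_nonneg.mpr hn.le
  have hi1 : ((2 * (r : ℝ) + 1))⁻¹ < 1 := inv_lt_one_of_one_lt₀ (by have h1 : (1 : ℝ) ≤ r := (by exact_mod_cast hr); linarith)
  have hβabs : |β| ≤ 1 := by
    rw [hβ]; split_ifs <;> rw [abs_le] <;> constructor <;> linarith
  have hβne : β ≠ 0 := by
    rw [hβ]; split_ifs <;> intro h <;> linarith
  have hmat : NormedSpace.exp ((β • Fp Q : lieSU n) : Matrix n n ℂ) = 1 := by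
    have := congrArg (fun g : Matrix.specialUnitaryGroup n ℂ => (g : Matrix n n ℂ)) hexp
    simpa only [coe_expSU, OneMemClass.coe_one] using this
  have hsmall : ‖((β • Fp Q : lieSU n) : Matrix n n ℂ)‖ < Real.log 2 := by
    rw [Submodule.coe_smul, norm_smul, Real.norm_eq_abs]
    calc |β| * ‖((Fp Q : lieSU n) : Matrix n n ℂ)‖ ≤ 1 * ‖((Fp Q : lieSU n) : Matrix n n ℂ)‖ := mul_le_mul_of_nonneg_right hβabs (norm_nonneg _)
      _ < Real.log 2 := by rw [one_mul]; exact hFn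
  have hzero : ((β • Fp Q : lieSU n) : Matrix n n ℂ) = 0 := by
    have h := B7BlockAvgLog.mlog_exp hsmall
    rw [hmat, MatrixLog.mlog_one] at h
    exact h.symm
  have hF0 : ((Fp Q : lieSU n) : Matrix n n ℂ) = 0 := by
    rw [Submodule.coe_smul] at hzero
    exact (smul_eq_zero.mp hzero).resolve_left hβne
  have hFp0 : Fp Q = 0 := Subtype.ext hF0
  -- hence the coarse plaquette is `1`
  have hF₀ := hF
  rw [hFp0, expSU_zero'] at hF₀
  apply hne
  have h1 : V ⟨Q.src, Q.ν⟩ * V ⟨Q.src.shift Q.ν, Q.μ⟩ * (V ⟨Q.src.shift Q.μ, Q.ν⟩)⁻¹ * (V ⟨Q.src, Q.μ⟩)⁻¹ = 1 := hF₀.symm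
  show V ⟨Q.src, Q.μ⟩ * V ⟨Q.src.shift Q.μ, Q.ν⟩ * (V ⟨Q.src.shift Q.ν, Q.μ⟩)⁻¹ * (V ⟨Q.src, Q.ν⟩)⁻¹ = 1
  have h2 := congrArg (fun g => g⁻¹) h1
  simp only [mul_inv_rev, inv_inv, inv_one] at h2
  simpa [mul_assoc] using h2

variable (IsBall : Site P 0 → Prop) (InBall : Site P 0 → PBond P 0 → Prop) (C : Plaq P 0 → Prop)

/-- **★★ (A5 = hcov), GENERIC**: for ANY predicate `C` implied by «all four corners in Ω», any rule `σ`, `r ≥ 1`, radii `1 ≤ Rt`, `Rt + 2 ≤ L^k`, `2·max(Rt,⌊L^k/2⌋)+1 ≤ N₀`, `Ω` `k`-saturated,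
and logarithms with `expSU F′_Q = V(∂Q)⁻¹`-word, `‖F′_Q‖ < log 2` on the tubes `Q ∈ plaqsIn k Ω`: every `C`-plaquette on which the section is not flat touches an ACTIVE bond of a tube.
[cite: Balaban1985Variational, (11)–(14) pp.279–280; Balaban1985Averaging, (21) p.21] -/
theorem hcov_of_corners (hk : k ≤ P.m + P.K) (Ω : Set (Site P 0)) (hsat : ∀ x x' : Site P 0, coarsen k x = coarsen k x' → (x ∈ Ω ↔ x' ∈ Ω))
    (htf : ∀ z : Site P k, coarsen k (toFine k z) = z) (hC : ∀ q, C q → q ∈ plaqsIn 0 Ω)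
    (hr : 1 ≤ r) (h1Rt : 1 ≤ Rt) (hRt : Rt + 2 ≤ P.L ^ k) (hN : 2 * max Rt (P.L ^ k / 2) + 1 ≤ P.sitesPerDir 0)
    (hF : ∀ Q : Plaq P k, Q ∈ plaqsIn k Ω → expSU (Fp Q) = V ⟨Q.src, Q.ν⟩ * V ⟨Q.src.shift Q.ν, Q.μ⟩ * (V ⟨Q.src.shift Q.μ, Q.ν⟩)⁻¹ * (V ⟨Q.src, Q.μ⟩)⁻¹)
    (hFn : ∀ Q : Plaq P k, Q ∈ plaqsIn k Ω → ‖((Fp Q : lieSU n) : Matrix n n ℂ)‖ < Real.log 2) :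
    ∀ q : Plaq P 0, C q → ¬ Plaq.Deep IsBall InBall q → GaugeField.plaqHol (iterSec k V) q ≠ 1 →
      ∃ Q b, Plaq.HasBond q b ∧ TubeActive V Rt Fp (fun Q => stringInd Q.μ Q.ν + betaQB r (σ Q).1 (σ Q).2 Q.μ Q.ν) (· ∈ plaqsIn k Ω) Q b := by
  intro q hCq _ hne1
  have hq : q ∈ plaqsIn 0 Ω := hC q hCq
  obtain ⟨hμ, hν, hval⟩ := plaqHol_iterSec_ne_one_imp hk V q hne1
  have hμν : q.μ ≠ q.ν := ne_of_lt q.hμν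
  -- the edge of `q` is a tube, and its coarse plaquette is not `1`
  have hTube : (⟨coarsen k q.src, q.μ, q.ν, q.hμν⟩ : Plaq P k) ∈ plaqsIn k Ω := isTube_of_corner hk Ω hsat htf q hq hμ hν
  have hneQ : GaugeField.plaqHol V ⟨coarsen k q.src, q.μ, q.ν, q.hμν⟩ ≠ 1 := fun h => hne1 (hval.trans h)
  -- chart of `q.src`: `(0, 0, ·)`
  have hsrc : boxSite (cornerSite k (coarsen k q.src) q.μ q.ν) (chartCoord k q.src q.μ q.ν) = q.src := boxSite_cornerSite_chartCoord k q.src q.μ q.ν hk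
  have huμ : chartCoord k q.src q.μ q.ν q.μ = 0 := chartCoord_eq_zero_of_last k q.src q.μ q.ν (Or.inl rfl) hμ hν
  have huν : chartCoord k q.src q.μ q.ν q.ν = 0 := chartCoord_eq_zero_of_last k q.src q.μ q.ν (Or.inr rfl) hμ hν
  have huT : InTube q.μ q.ν Rt (P.L ^ k / 2) (chartCoord k q.src q.μ q.ν) := inTube_chartCoord_of_last k q.src q.μ q.ν Rt hμ hν
  -- near-corner chart points are in the tube box
  have hIn : ∀ v : Fin P.d → ℤ, |v q.μ| ≤ 1 → |v q.ν| ≤ 1 → (∀ i, ¬ (i = q.μ ∨ i = q.ν) → v i = chartCoord k q.src q.μ q.ν i) →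
      InTube q.μ q.ν Rt (P.L ^ k / 2) v := by
    intro v h1 h2 h3 i
    by_cases hi : i = q.μ ∨ i = q.ν
    · rw [if_pos hi]
      rcases hi with rfl | rfl
      · exact h1.trans (by exact_mod_cast h1Rt)
      · exact h2.trans (by exact_mod_cast h1Rt)
    · rw [h3 i hi]; exact huT i
  by_cases hnm : (σ ⟨coarsen k q.src, q.μ, q.ν, q.hμν⟩).1 = true
  · -- quadrant on the `u_μ ≤ 0` side: test bond `⟨q.src, ν⟩` = chart `(0,0,·)`
    refine ⟨⟨coarsen k q.src, q.μ, q.ν, q.hμν⟩, ⟨q.src, q.ν⟩, Or.inr (Or.inr (Or.inr rfl)), hTube, ?_⟩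
    have h := tubeField_ne_iterSec_of_nu_bond σ r V Rt Fp hk hr hRt hN ⟨coarsen k q.src, q.μ, q.ν, q.hμν⟩ (hF _ hTube) (hFn _ hTube) hneQ
      (chartCoord k q.src q.μ q.ν) huν (by rw [hnm, if_pos rfl]; exact huμ) huT
      (hIn _ (by rw [add_e_apply_ne _ hμν, huμ]; simp) (by rw [add_e_apply_same, huν]; simp)
        (fun i hi => by rw [not_or] at hi; rw [add_e_apply_ne _ hi.2]))
    rwa [hsrc] at h
  · -- quadrant on the `u_μ ≥ 1` side: test bond `⟨q.src + e_μ, ν⟩` = chart `(1,0,·)`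
    rw [Bool.not_eq_true] at hnm
    refine ⟨⟨coarsen k q.src, q.μ, q.ν, q.hμν⟩, ⟨q.src.shift q.μ, q.ν⟩, Or.inr (Or.inl rfl), hTube, ?_⟩
    have h := tubeField_ne_iterSec_of_nu_bond σ r V Rt Fp hk hr hRt hN ⟨coarsen k q.src, q.μ, q.ν, q.hμν⟩ (hF _ hTube) (hFn _ hTube) hneQ
      (chartCoord k q.src q.μ q.ν + e q.μ) (by rw [add_e_apply_ne _ hμν.symm, huν]) (by rw [hnm, add_e_apply_same, huμ]; simp)
      (hIn _ (by rw [add_e_apply_same, huμ]; simp) (by rw [add_e_apply_ne _ hμν.symm, huν]; simp) (fun i hi => by rw [not_or] at hi; rw [add_e_apply_ne _ hi.1]))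
      (hIn _ (by rw [add_e_apply_ne _ hμν, add_e_apply_same, huμ]; simp) (by rw [add_e_apply_same, add_e_apply_ne _ hμν.symm, huν]; simp)
        (fun i hi => by rw [not_or] at hi; rw [add_e_apply_ne _ hi.2, add_e_apply_ne _ hi.1]))
    rwa [boxSite_add_e, hsrc] at h

/-- **★★ (A5 = hcov) FOR THE CANONICAL SYSTEM** of `…v3StartSystem` (`tfOf k Ω`, `IsTubeΩ k Ω`, `FpOf k V`, `RtT`; any `C` implied by four corners in `Ω`): region binders `16 ≤ L^k`,
`4·L^k ≤ N₀`, `Ω` `k`-saturated; field binder: `V(∂Q)⁻¹` in the log window on the tubes. [cite: Balaban1985Variational, (11)–(14) pp.279–280] -/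
theorem hcov_startSys (hk : k ≤ P.m + P.K) (Ω : Set (Site P 0)) (hsat : ∀ x x' : Site P 0, coarsen k x = coarsen k x' → (x ∈ Ω ↔ x' ∈ Ω))
    (htf : ∀ z : Site P k, coarsen k (toFine k z) = z) (hC : ∀ q, C q → q ∈ plaqsIn 0 Ω) (hL : 16 ≤ P.L ^ k) (hN : 4 * P.L ^ k ≤ P.sitesPerDir 0)
    (hwin : ∀ Q : Plaq P k, Q ∈ plaqsIn k Ω → ‖((wordQ k V Q : Matrix.specialUnitaryGroup n ℂ) : Matrix n n ℂ) - 1‖ ≤ 1 / 4 ∧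
      (Fintype.card n : ℝ) * ‖((wordQ k V Q : Matrix.specialUnitaryGroup n ℂ) : Matrix n n ℂ) - 1‖ < Real.pi) :
    ∀ q : Plaq P 0, C q → ¬ Plaq.Deep IsBall InBall q → GaugeField.plaqHol (iterSec k V) q ≠ 1 →
      ∃ Q b, Plaq.HasBond q b ∧ TubeActive V (RtT P k) (FpOf k V) (tfOf k Ω) (IsTubeΩ k Ω) Q b := by
  have hr : 1 ≤ rT P k := by unfold rT; omega
  have h1Rt : 1 ≤ RtT P k := by unfold RtT; omega
  have hRt : RtT P k + 2 ≤ P.L ^ k := by unfold RtT rT; omega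
  have hN' : 2 * max (RtT P k) (P.L ^ k / 2) + 1 ≤ P.sitesPerDir 0 := by
    have : max (RtT P k) (P.L ^ k / 2) ≤ P.L ^ k / 2 := max_le (by unfold RtT rT; omega) le_rfl
    omega
  have hF : ∀ Q : Plaq P k, Q ∈ plaqsIn k Ω → expSU (FpOf k V Q) = V ⟨Q.src, Q.ν⟩ * V ⟨Q.src.shift Q.ν, Q.μ⟩ * (V ⟨Q.src.shift Q.μ, Q.ν⟩)⁻¹ * (V ⟨Q.src, Q.μ⟩)⁻¹ :=
    fun Q hQ => expSU_FpOf k V Q (hwin Q hQ)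
  have hFn : ∀ Q : Plaq P k, Q ∈ plaqsIn k Ω → ‖((FpOf k V Q : lieSU n) : Matrix n n ℂ)‖ < Real.log 2 := fun Q hQ => by
    have h := norm_FpOf_le k V Q
    have hw := (hwin Q hQ).1
    have hl := Real.log_two_gt_d9
    linarith
  exact hcov_of_corners (fun Q => quadOf Ω Q) (rT P k) V (RtT P k) (FpOf k V) IsBall InBall C hk Ω hsat htf hC hr h1Rt hRt hN' hF hFn

end Coverage

end Summit.QuantumFields.YangMills.Theorems.TubeStart

end
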